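import Summits.BirchSwinnertonDyer.BirchSwinnertonDyer.Theorems.PrintCf2RubinValueTwoBrickCD4ChiTameSign
import Literature.NumberTheory.GaloisRepresentations.LubinTateColemanCoordCoinvariantContinuousTwo
import HarnessLib

/-!
# Brick (c) at `p = 2`, module M-ASM of the multiplier form: the TARGET SET `𝒯(f, I) = {β ∈ U¹_∞ | f·[β] ∈ I}` (`[β] = φ_ε(Σ Col β)`) is a CLOSED
# sub-monoid of `U¹_∞` stable under inverses — for every ideal `I ⊆ Λ` and every multiplier `f ∈ Λ`

Cell `bsd-print-cf2`, width seat `bsd-line-cf2c-w7` g28, route C `PrintCf2RubinValueTwo`, crux of record stmt-BirchSwinnertonDyer-24033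
`TwoVariableMainConjAtSplitTwoQuad` (23720 nominal), BRICK §4(c); memo v8 `Cruxes/TwoVariableMainConjAtSplitTwoQuad/BRICK-C-D4CHI-g28.md` §1 (architecture of the
multiplier form `H` of `…CoprimeSix_of_multipliers`, p825379).  The multiplier form asks `f_𝔠·[β] ∈ I_A` for every `β ∈ B_χ`; the proof runs through the target set
`𝒯 = {β ∈ U¹_∞ | f·[β] ∈ I_A}`: `B_χ ⊆ 𝒯` is obtained LEVELWISE (the readouts `ψ_n(β)` lie in `ψ_n(𝒯)` by the depletion argument) and then by the levelwise-to-limit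
principle (`Literature/NumberTheory/EllipticCurves/PAdicTwoVariableLocalUnitsShiftedDiagonalLevelwise`), which needs `𝒯` CLOSED; the depletion argument needs `ψ_n(𝒯)` to
be a sub-monoid.  THIS file (generic local field `F` with `q = 2`, the Coleman frame of `…BrickCD4ChiTameSign`):

* ★★ `isClosed_setOf_mul_phi_colemanImage_mem` — `𝒯(f, I)` is closed in `∏_m 𝒰(E_m·K_π^∞)` (`β ↦ [β]` is continuous on the compact `U¹_∞`:
  `continuous_colemanImage`, `continuous_indexTraceₗ`, `continuous_colemanDeltaCoinvFun_intBase`; ideals of the compact Noetherian `Λ` are closed; `U¹_∞` is closed);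
* `one_mem_…`, `mul_mem_…`, `inv_mem_…` — `𝒯(f, I)` contains `1` and is closed under products and inverses (`[ββ'] = [β] + [β']`, `[β⁻¹] = −[β]`);
* `mem_setOf_mul_phi_colemanImage_mem_of_unit_mul` — `𝒯(f, I) = 𝒯(e·f, I)` for a unit `e` (odd integers, `3`, … are units of `Λ` at `p = 2`).
THEOREMS ONLY (0 sorry, no new definitions; the set is written out).  BSD is not proved by any of this; nothing here closes 24033 or 27037.

## References
* [deShalit1987] E. de Shalit, *Iwasawa theory of elliptic curves with complex multiplication* (1987), I §3.4 Lemma (i), Corollary, §3.7; III §1.3–1.4 (5).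
* [Washington1997] L. C. Washington, *Introduction to Cyclotomic Fields* (1997), §13.2 (compact `Λ`-modules).
-/

noncomputable section

set_option linter.dupNamespace false
set_option autoImplicit false

open Filter Topology
open scoped PowerSeries.WithPiTopology

namespace Summit.BirchSwinnertonDyer.BirchSwinnertonDyer.Theorems.PrintCf2.BrickCD4Chi

open Literature.NumberTheory.GaloisRepresentations Literature.NumberTheory.GaloisRepresentations.IsNonarchimedeanLocalField
  Literature.NumberTheory.GaloisRepresentations.LubinTate ValuativeRel Field
open Literature.NumberTheory.EllipticCurves
open Summit.BirchSwinnertonDyer.BirchSwinnertonDyer.Theorems.PrintCf2.ColemanImage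
open Summit.BirchSwinnertonDyer.BirchSwinnertonDyer.Theorems.PrintCf2.ColemanCoinvariantTrace

variable {F : Type} [Field F] [ValuativeRel F] [TopologicalSpace F] [IsNonarchimedeanLocalField F]

attribute [local instance] ltNormUniformSpace ltNormIsUniformAddGroup rk1 nF nE fintypeResidueField
attribute [local instance] RelNormCoherentUnits.instCommMonoid
attribute [local instance] isAdicComplete_maximalIdeal_powerSeries_integer

variable {p : ℕ} [hp : Fact p.Prime] {d : ℕ} (hd : d.Coprime p)
variable {π : 𝒪[F]} (hπ : (valuation F).IsUniformizer (π : F))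
variable (E : ℕ → IntermediateField F (AlgebraicClosure F)) [∀ m, FiniteDimensional F (E m)] [∀ m, Normal F (E m)]
  [∀ m, IsGalois F (E m)] (hmono : Monotone E) (hE : ∀ m, E m ≤ maxUnramified F) (hdeg : ∀ m, Module.finrank F (E m) = d * p ^ m)
  {σ₀ : absoluteGaloisGroup F} (hσ₀ : IsAbsArithFrob σ₀) (hq : residueFieldCard F = 2)
variable (u : (LTCoeff F)ˣ) (hu : LTCoeff.of F π = residueFieldCard F * u) (γ w : 𝒪[F]ˣ) (hγ : (γ : 𝒪[F]) = 1 + π ^ 2 * w)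
variable [IsAdicComplete (Ideal.span {intBase F (LTCoeff.of F π)}) (PowerSeries 𝒪[F])] [NeZero d]
variable {θ : ∀ m, unitBall (E m)} (hθ : ∀ m, IsIntegralNormalGen (E m) (θ m))
  (hcoh : ∀ m, unitBallTrace (hmono (Nat.le_succ m)) (θ (m + 1)) = θ m)
variable [IsAdicComplete (Ideal.span {(p : 𝒪[F])}) 𝒪[F]] (ε : PowerSeries (PowerSeries 𝒪[F]))
variable (I : Ideal (PowerSeries (PowerSeries 𝒪[F]))) (f : PowerSeries (PowerSeries 𝒪[F]))

include hdeg in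
/-- ★★ **The target set `𝒯(f, I) = {β ∈ U¹_∞ | f·φ_ε(Σ Col β) ∈ I}` is CLOSED** in `∏_m 𝒰(E_m·K_π^∞)`: it is the image, under the closed embedding `U¹_∞ ↪ ∏_m 𝒰`,
of the preimage of the closed ideal `I` under the continuous map `β ↦ f·φ_ε(Σ Col β)`. [cite: deShalit1987, I §3.4 Corollary, §3.7; III §1.4 (5)]
[cite: Washington1997, §13.2] -/
theorem isClosed_setOf_mul_phi_colemanImage_mem :
    IsClosed {β : ∀ m, RelNormCoherentUnits hπ (E m) | ∃ hβ : β ∈ principalCoherentFamilies hπ E hmono,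
      f * colemanDeltaCoinvFun hπ hq (intBase F) u hu γ (eq_zero_of_C_pi_mul_eq_zero_integer hπ) w hγ ε
        (indexTraceₗ hπ hq u hu γ (colemanImage hd hπ E hmono hE hdeg hσ₀ hq u hu γ hθ hcoh hβ.1)) ∈ I} := by
  haveI : CompactSpace (PowerSeries 𝒪[F]) := PowerSeries.WithPiTopology.compactSpace _
  haveI : CompactSpace (PowerSeries (PowerSeries 𝒪[F])) := PowerSeries.WithPiTopology.compactSpace _
  -- the continuous map on the subtype `U¹_∞`
  let Φ : principalCoherentFamilies hπ E hmono → PowerSeries (PowerSeries 𝒪[F]) := fun b ↦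
    f * colemanDeltaCoinvFun hπ hq (intBase F) u hu γ (eq_zero_of_C_pi_mul_eq_zero_integer hπ) w hγ ε
      (indexTraceₗ hπ hq u hu γ (colemanImage hd hπ E hmono hE hdeg hσ₀ hq u hu γ hθ hcoh b.2.1))
  have hΦ : Continuous Φ :=
    continuous_const.mul ((continuous_colemanDeltaCoinvFun_intBase hπ hq u hu γ w hγ ε).comp
      ((continuous_indexTraceₗ hπ hq u hu γ).comp (continuous_colemanImage hd hπ E hmono hE hdeg hσ₀ hq u hu γ hθ hcoh)))
  have hI : IsClosed ((I : Set (PowerSeries (PowerSeries 𝒪[F])))) := Ideal.isClosed_of_isNoetherianRing _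
  have e : {β : ∀ m, RelNormCoherentUnits hπ (E m) | ∃ hβ : β ∈ principalCoherentFamilies hπ E hmono,
      f * colemanDeltaCoinvFun hπ hq (intBase F) u hu γ (eq_zero_of_C_pi_mul_eq_zero_integer hπ) w hγ ε
        (indexTraceₗ hπ hq u hu γ (colemanImage hd hπ E hmono hE hdeg hσ₀ hq u hu γ hθ hcoh hβ.1)) ∈ I} =
      Subtype.val '' (Φ ⁻¹' (I : Set (PowerSeries (PowerSeries 𝒪[F])))) := by
    ext β
    constructor
    · rintro ⟨hβ, h⟩
      exact ⟨⟨β, hβ⟩, h, rfl⟩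
    · rintro ⟨b, hb, rfl⟩
      exact ⟨b.2, hb⟩
  rw [e]
  exact (isClosed_principalCoherentFamilies hπ E hmono).isClosedEmbedding_subtypeVal.isClosedMap _ (hI.preimage hΦ)

include hdeg in
/-- `1 ∈ 𝒯(f, I)` (`[1] = 0`). [cite: deShalit1987, I §3.4 Lemma (i)] -/
theorem one_mem_setOf_mul_phi_colemanImage_mem :
    (fun m ↦ (RelNormCoherentUnits.one : RelNormCoherentUnits hπ (E m))) ∈
      {β : ∀ m, RelNormCoherentUnits hπ (E m) | ∃ hβ : β ∈ principalCoherentFamilies hπ E hmono,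
        f * colemanDeltaCoinvFun hπ hq (intBase F) u hu γ (eq_zero_of_C_pi_mul_eq_zero_integer hπ) w hγ ε
          (indexTraceₗ hπ hq u hu γ (colemanImage hd hπ E hmono hE hdeg hσ₀ hq u hu γ hθ hcoh hβ.1)) ∈ I} := by
  refine ⟨one_mem_principalCoherentFamilies hπ E hmono, ?_⟩
  rw [colemanImage_one hd hπ E hmono hE hdeg hσ₀ hq u hu γ hθ hcoh, map_zero, map_zero, mul_zero]
  exact I.zero_mem

include hdeg in
/-- `𝒯(f, I)` is closed under products (`[ββ'] = [β] + [β']`). [cite: deShalit1987, I §3.4 Lemma (i)] -/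
theorem mul_mem_setOf_mul_phi_colemanImage_mem {β β' : ∀ m, RelNormCoherentUnits hπ (E m)}
    (hβ : β ∈ {β : ∀ m, RelNormCoherentUnits hπ (E m) | ∃ hβ : β ∈ principalCoherentFamilies hπ E hmono,
      f * colemanDeltaCoinvFun hπ hq (intBase F) u hu γ (eq_zero_of_C_pi_mul_eq_zero_integer hπ) w hγ ε
        (indexTraceₗ hπ hq u hu γ (colemanImage hd hπ E hmono hE hdeg hσ₀ hq u hu γ hθ hcoh hβ.1)) ∈ I})
    (hβ' : β' ∈ {β : ∀ m, RelNormCoherentUnits hπ (E m) | ∃ hβ : β ∈ principalCoherentFamilies hπ E hmono,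
      f * colemanDeltaCoinvFun hπ hq (intBase F) u hu γ (eq_zero_of_C_pi_mul_eq_zero_integer hπ) w hγ ε
        (indexTraceₗ hπ hq u hu γ (colemanImage hd hπ E hmono hE hdeg hσ₀ hq u hu γ hθ hcoh hβ.1)) ∈ I}) :
    (fun m ↦ (β m).mul (β' m)) ∈ {β : ∀ m, RelNormCoherentUnits hπ (E m) | ∃ hβ : β ∈ principalCoherentFamilies hπ E hmono,
      f * colemanDeltaCoinvFun hπ hq (intBase F) u hu γ (eq_zero_of_C_pi_mul_eq_zero_integer hπ) w hγ ε
        (indexTraceₗ hπ hq u hu γ (colemanImage hd hπ E hmono hE hdeg hσ₀ hq u hu γ hθ hcoh hβ.1)) ∈ I} := by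
  obtain ⟨h₁, hm₁⟩ := hβ
  obtain ⟨h₂, hm₂⟩ := hβ'
  refine ⟨mul_mem_principalCoherentFamilies hπ E hmono h₁ h₂, ?_⟩
  have e := phi_colemanImage_mul hd hπ E hmono hE hdeg hσ₀ hq u hu γ w hγ hθ hcoh ε h₁ h₂ (mul_mem_principalCoherentFamilies hπ E hmono h₁ h₂).1
  change f * colemanDeltaCoinvFun hπ hq (intBase F) u hu γ (eq_zero_of_C_pi_mul_eq_zero_integer hπ) w hγ ε
    (indexTraceₗ hπ hq u hu γ (colemanImage hd hπ E hmono hE hdeg hσ₀ hq u hu γ hθ hcoh (β := β * β')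
      (mul_mem_principalCoherentFamilies hπ E hmono h₁ h₂).1)) ∈ I
  rw [e, mul_add]
  exact I.add_mem hm₁ hm₂

include hdeg in
/-- `𝒯(f, I)` is closed under inverses (`[β⁻¹] = −[β]`). [cite: deShalit1987, I §3.4 Lemma (i)] -/
theorem inv_mem_setOf_mul_phi_colemanImage_mem {β : ∀ m, RelNormCoherentUnits hπ (E m)}
    (hβ : β ∈ {β : ∀ m, RelNormCoherentUnits hπ (E m) | ∃ hβ : β ∈ principalCoherentFamilies hπ E hmono,
      f * colemanDeltaCoinvFun hπ hq (intBase F) u hu γ (eq_zero_of_C_pi_mul_eq_zero_integer hπ) w hγ ε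
        (indexTraceₗ hπ hq u hu γ (colemanImage hd hπ E hmono hE hdeg hσ₀ hq u hu γ hθ hcoh hβ.1)) ∈ I}) :
    (fun m ↦ (β m).inv hπ (E m)) ∈ {β : ∀ m, RelNormCoherentUnits hπ (E m) | ∃ hβ : β ∈ principalCoherentFamilies hπ E hmono,
      f * colemanDeltaCoinvFun hπ hq (intBase F) u hu γ (eq_zero_of_C_pi_mul_eq_zero_integer hπ) w hγ ε
        (indexTraceₗ hπ hq u hu γ (colemanImage hd hπ E hmono hE hdeg hσ₀ hq u hu γ hθ hcoh hβ.1)) ∈ I} := by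
  obtain ⟨h₁, hm₁⟩ := hβ
  refine ⟨inv_mem_principalCoherentFamilies hπ E hmono h₁, ?_⟩
  rw [phi_colemanImage_inv hd hπ E hmono hE hdeg hσ₀ hq u hu γ w hγ hθ hcoh ε h₁, mul_neg]
  exact I.neg_mem hm₁

include hdeg in
/-- `𝒯(f, I) ⊆ 𝒯(g·f, I)` for every `g ∈ Λ`, with equality for a unit `g` — the target set only depends on the ideal `(f)` (so odd integers and other units of
`Λ` may be absorbed into the multiplier). [cite: deShalit1987, III §1.4 (5)] -/
theorem mem_setOf_mul_phi_colemanImage_mem_of_mul (g : PowerSeries (PowerSeries 𝒪[F])) {β : ∀ m, RelNormCoherentUnits hπ (E m)}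
    (hβ : β ∈ {β : ∀ m, RelNormCoherentUnits hπ (E m) | ∃ hβ : β ∈ principalCoherentFamilies hπ E hmono,
      f * colemanDeltaCoinvFun hπ hq (intBase F) u hu γ (eq_zero_of_C_pi_mul_eq_zero_integer hπ) w hγ ε
        (indexTraceₗ hπ hq u hu γ (colemanImage hd hπ E hmono hE hdeg hσ₀ hq u hu γ hθ hcoh hβ.1)) ∈ I}) :
    β ∈ {β : ∀ m, RelNormCoherentUnits hπ (E m) | ∃ hβ : β ∈ principalCoherentFamilies hπ E hmono,
      (g * f) * colemanDeltaCoinvFun hπ hq (intBase F) u hu γ (eq_zero_of_C_pi_mul_eq_zero_integer hπ) w hγ ε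
        (indexTraceₗ hπ hq u hu γ (colemanImage hd hπ E hmono hE hdeg hσ₀ hq u hu γ hθ hcoh hβ.1)) ∈ I} := by
  obtain ⟨h₁, hm₁⟩ := hβ
  refine ⟨h₁, ?_⟩
  rw [mul_assoc]
  exact I.mul_mem_left g hm₁

include hdeg in
/-- For a UNIT `e` of `Λ`: `β ∈ 𝒯(e·f, I) → β ∈ 𝒯(f, I)`. [cite: deShalit1987, III §1.4 (5)] -/
theorem mem_setOf_mul_phi_colemanImage_mem_of_unit_mul {e : PowerSeries (PowerSeries 𝒪[F])} (he : IsUnit e)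
    {β : ∀ m, RelNormCoherentUnits hπ (E m)}
    (hβ : β ∈ {β : ∀ m, RelNormCoherentUnits hπ (E m) | ∃ hβ : β ∈ principalCoherentFamilies hπ E hmono,
      (e * f) * colemanDeltaCoinvFun hπ hq (intBase F) u hu γ (eq_zero_of_C_pi_mul_eq_zero_integer hπ) w hγ ε
        (indexTraceₗ hπ hq u hu γ (colemanImage hd hπ E hmono hE hdeg hσ₀ hq u hu γ hθ hcoh hβ.1)) ∈ I}) :
    β ∈ {β : ∀ m, RelNormCoherentUnits hπ (E m) | ∃ hβ : β ∈ principalCoherentFamilies hπ E hmono,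
      f * colemanDeltaCoinvFun hπ hq (intBase F) u hu γ (eq_zero_of_C_pi_mul_eq_zero_integer hπ) w hγ ε
        (indexTraceₗ hπ hq u hu γ (colemanImage hd hπ E hmono hE hdeg hσ₀ hq u hu γ hθ hcoh hβ.1)) ∈ I} := by
  obtain ⟨h₁, hm₁⟩ := hβ
  refine ⟨h₁, ?_⟩
  obtain ⟨e', rfl⟩ := he
  have := I.mul_mem_left ((e'⁻¹ : (PowerSeries (PowerSeries 𝒪[F]))ˣ) : PowerSeries (PowerSeries 𝒪[F])) hm₁
  rwa [← mul_assoc, ← mul_assoc, Units.inv_mul, one_mul] at this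

end Summit.BirchSwinnertonDyer.BirchSwinnertonDyer.Theorems.PrintCf2.BrickCD4Chi

end
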